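import Literature.Algebra.Homology.MapBifunctorIsoOfComponents
import Literature.AlgebraicGeometry.Modules.BoxTensorPullback
import Literature.AlgebraicGeometry.Modules.TensorAssociator
import Literature.AlgebraicGeometry.Modules.TensorSheafHomAdjunction
import Literature.AlgebraicGeometry.Modules.InvertibleModule
import HarnessLib

/-!
# Base change and twist of the external tensor product of complexes:
# `(u^*R) ⊠_{p',q'} S ≅ g^*(R ⊠_{p,q} S)` and `R ⊠ (N ⊗ S) ≅ q^*N ⊗ (R ⊠ S)` as cochain complexes

Layer `Literature/AlgebraicGeometry/Modules`; chain-level sequel to `Modules/BoxTensorPullback` (the objectwise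
`g^*(E ⊠ F) ≅ u^*E ⊠ v^*F` for vector bundles) and `Modules/BoxTensor` (`boxTensorComplex p q R S` = Mathlib's `mapBifunctor` of
`boxTensorFunctor p q`, the total complex of `(i, j) ↦ p^*Rⁱ ⊗ q^*Sʲ`). For schemes and a map of spans with `g ≫ p = p' ≫ u`,
`g ≫ q = q'` (`p : Z ⟶ X`, `q : Z ⟶ Y`, `p' : Z' ⟶ X'`, `q' : Z' ⟶ Y`, `g : Z' ⟶ Z`, `u : X' ⟶ X`), cochain complexes `R` on `X`, `S` on `Y`
with FINITE LOCALLY FREE TERMS, and a finite locally free `N` on `Y`, this file PROVES (0 named facts, no instances):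

* §1 the term isomorphisms and their naturality: `pullbackBoxTensorIso' : g^*(E ⊠_{p,q} F) ≅ (u^*E) ⊠_{p',q'} F` (the tree's
  `pullbackTensorIso` + the square `g ≫ p = p' ≫ u` + `g ≫ q = q'`), `boxTensorTwistIso : E ⊠ (N ⊗ F) ≅ q^*N ⊗ (E ⊠ F)`
  (`pullbackTensorIso q` + associator + symmetry), each NATURAL in maps of vector bundles `E → E'`, `F → F'`;
* §2 **`pullbackBoxTensorComplexIso : (u^*•R) ⊠_{p',q'} S ≅ g^*•(R ⊠_{p,q} S)`**,
  **`boxTensorComplexTwistIso : R ⊠ (N ⊗ •S) ≅ (q^*N ⊗ –)•(R ⊠ S)`**, and their composite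
  **`boxTensorComplexTwistPullbackIso : (u^*•R) ⊠_{p',q'} (N ⊗ •S) ≅ g^*•((q^*N ⊗ –)•(R ⊠_{p,q} S))`** — isomorphisms of COCHAIN
  COMPLEXES (`Algebra/Homology/MapBifunctorIsoOfComponents` on the term isomorphisms; `g^*` and `q^*N ⊗ –` are left adjoints, so
  they preserve the coproducts of the total complex).

Here `Φ•K := (Φ.mapHomologicalComplex (ComplexShape.up ℤ)).obj K`. The instance for abelian varieties (`Z = Z' = A × B`, `p = p' = pr₁`,
`q = q' = pr₂`, `g = t_a × 1`, `u = t_a`: `(t_a^*R) ⊠ (N ⊗ S) ≅ (t_a × 1)^*(pr₂^*N ⊗ (R ⊠ S))`) is left to the consumer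
(`StrictlyPerfectResolution.pullbackIso_P ∕ twist_P` supply the left side). Typed for the cell `pub-hodge-ring2` (plate F13 «box
compatibility» of crux 26512's (M1) library debt: with F12's ROW Φ-(iii) it turns the socket's `e₂` into `e₁`; a research route conditional
on HC_CM, not a corollary — nothing in this file refers to it).

## References

* The Stacks Project, Tag 01CA (Lemma 17.16.4: pull-back is monoidal), Tag 0FXX (`K ⊠ M`), Tag 012Z (total complex). [StacksProject]
* U. Görtz, T. Wedhorn, *Algebraic Geometry II* (2023), (22.25) before Cor. 22.110 (p. 286). [GortzWedhorn2023]
* C. A. Weibel, *An introduction to homological algebra* (1994), §1.2, 1.2.6 and §2.6. [Weibel1994]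
-/

noncomputable section

-- `TopCat.Presheaf`/`Scheme.Modules` are not reducible (as in Mathlib's `AlgebraicGeometry/Modules/Sheaf.lean`).
set_option backward.isDefEq.respectTransparency false

open CategoryTheory CategoryTheory.Limits AlgebraicGeometry
open AlgebraicGeometry.Scheme.Modules

universe u

namespace Literature.AlgebraicGeometry.Modules

open Literature.AlgebraicGeometry.Motives Literature.Algebra.Homology

variable {X X' Y Z Z' : Scheme.{u}} {p : Z ⟶ X} {q : Z ⟶ Y} {p' : Z' ⟶ X'} {q' : Z' ⟶ Y} {g : Z' ⟶ Z} {u : X' ⟶ X}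

/-! ### §1 Term isomorphisms and their naturality -/

section Terms

/-- Naturality of `pullbackSquareIso h E : g^*p^*E ≅ p'^*u^*E` in `E` (it is a component of the natural isomorphism
`pullbackComp ≪≫ pullbackCongr ≪≫ pullbackComp⁻¹`). [cite: StacksProject, Tag 01C8] -/
theorem pullbackSquareIso_hom_naturality (h : g ≫ p = p' ≫ u) {E E' : X.Modules} (φ : E ⟶ E') :
    (Scheme.Modules.pullback g).map ((Scheme.Modules.pullback p).map φ) ≫ (pullbackSquareIso h E').hom =
      (pullbackSquareIso h E).hom ≫ (Scheme.Modules.pullback p').map ((Scheme.Modules.pullback u).map φ) :=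
  (Scheme.Modules.pullbackComp g p ≪≫ Scheme.Modules.pullbackCongr h ≪≫ (Scheme.Modules.pullbackComp p' u).symm).hom.naturality φ

/-- `g^*q^*F ≅ q'^*F` for `g ≫ q = q'`. [cite: StacksProject, Tag 01C8] -/
def pullbackCompIso' (hq : g ≫ q = q') (F : Y.Modules) :
    (Scheme.Modules.pullback g).obj ((Scheme.Modules.pullback q).obj F) ≅ (Scheme.Modules.pullback q').obj F :=
  (Scheme.Modules.pullbackComp g q ≪≫ Scheme.Modules.pullbackCongr hq).app F

/-- Naturality of `pullbackCompIso'` in `F`. [cite: StacksProject, Tag 01C8] -/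
theorem pullbackCompIso'_hom_naturality (hq : g ≫ q = q') {F F' : Y.Modules} (ψ : F ⟶ F') :
    (Scheme.Modules.pullback g).map ((Scheme.Modules.pullback q).map ψ) ≫ (pullbackCompIso' hq F').hom =
      (pullbackCompIso' hq F).hom ≫ (Scheme.Modules.pullback q').map ψ :=
  (Scheme.Modules.pullbackComp g q ≪≫ Scheme.Modules.pullbackCongr hq).hom.naturality ψ

/-- **`g^*(E ⊠_{p,q} F) ≅ (u^*E) ⊠_{p',q'} F`** for `g ≫ p = p' ≫ u`, `g ≫ q = q'` and finite locally free `E`, `F` (pull-back is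
monoidal on vector bundles, then the square and the triangle). [cite: StacksProject, Tag 01CA (Lemma 17.16.4)]
[cite: GortzWedhorn2023, §(22.25) (p. 286)] -/
def pullbackBoxTensorIso' (hp : g ≫ p = p' ≫ u) (hq : g ≫ q = q') {E : X.Modules} {F : Y.Modules}
    (hE : IsFiniteLocallyFree E) (hF : IsFiniteLocallyFree F) :
    (Scheme.Modules.pullback g).obj (boxTensor p q E F) ≅ boxTensor p' q' ((Scheme.Modules.pullback u).obj E) F :=
  pullbackTensorIso g (hE.pullback p) (hF.pullback q) ≪≫ tensorMapIso (pullbackSquareIso hp E) (pullbackCompIso' hq F)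

/-- Unfolding of `pullbackBoxTensorIso'`. [cite: StacksProject, Tag 01CA (Lemma 17.16.4)] -/
theorem pullbackBoxTensorIso'_hom (hp : g ≫ p = p' ≫ u) (hq : g ≫ q = q') {E : X.Modules} {F : Y.Modules}
    (hE : IsFiniteLocallyFree E) (hF : IsFiniteLocallyFree F) :
    (pullbackBoxTensorIso' hp hq hE hF).hom =
      pullbackTensorHom g _ _ ≫ tensorMap (pullbackSquareIso hp E).hom (pullbackCompIso' hq F).hom := rfl

/-- **Naturality of `pullbackBoxTensorIso'`** in maps of vector bundles `φ : E → E'`, `ψ : F → F'`: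
`g^*(φ ⊠ ψ) ≫ iso = iso ≫ (u^*φ ⊠ ψ)`. [cite: StacksProject, Tag 01CA (Lemma 17.16.4)] -/
theorem pullbackBoxTensorIso'_hom_naturality (hp : g ≫ p = p' ≫ u) (hq : g ≫ q = q') {E E' : X.Modules} {F F' : Y.Modules}
    (hE : IsFiniteLocallyFree E) (hE' : IsFiniteLocallyFree E') (hF : IsFiniteLocallyFree F) (hF' : IsFiniteLocallyFree F')
    (φ : E ⟶ E') (ψ : F ⟶ F') :
    (Scheme.Modules.pullback g).map (boxTensorMap p q φ ψ) ≫ (pullbackBoxTensorIso' hp hq hE' hF').hom =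
      (pullbackBoxTensorIso' hp hq hE hF).hom ≫
        boxTensorMap p' q' ((Scheme.Modules.pullback u).map φ) ψ := by
  rw [pullbackBoxTensorIso'_hom, pullbackBoxTensorIso'_hom, boxTensorMap, boxTensorMap, ← Category.assoc,
    pullbackTensorHom_naturality, Category.assoc, Category.assoc, ← tensorMap_comp, ← tensorMap_comp,
    pullbackSquareIso_hom_naturality, pullbackCompIso'_hom_naturality]

/-- Naturality of the inverse of the associator. [cite: StacksProject, Tag 01CA (Lemma 17.16.1)] -/
@[reassoc]
theorem tensorAssoc_inv_naturality {L L' M M' N N' : Z.Modules} (f : L ⟶ L') (k : M ⟶ M') (h : N ⟶ N') :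
    tensorMap f (tensorMap k h) ≫ (tensorAssoc L' M' N').inv = (tensorAssoc L M N).inv ≫ tensorMap (tensorMap f k) h := by
  rw [Iso.comp_inv_eq, Category.assoc, Iso.eq_inv_comp, tensorAssoc_naturality]

/-- **`E ⊠ (N ⊗ F) ≅ q^*N ⊗ (E ⊠ F)`** for finite locally free `N`, `F` on `Y` (pull-back monoidal on vector bundles, associator,
symmetry): `p^*E ⊗ q^*(N ⊗ F) ≅ p^*E ⊗ (q^*N ⊗ q^*F) ≅ (p^*E ⊗ q^*N) ⊗ q^*F ≅ (q^*N ⊗ p^*E) ⊗ q^*F ≅ q^*N ⊗ (p^*E ⊗ q^*F)`.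
[cite: StacksProject, Tag 01CA (Lemma 17.16.1 and Lemma 17.16.4)] -/
def boxTensorTwistIso (p : Z ⟶ X) (q : Z ⟶ Y) (E : X.Modules) {N F : Y.Modules} (hN : IsFiniteLocallyFree N)
    (hF : IsFiniteLocallyFree F) :
    boxTensor p q E (tensorObj N F) ≅ tensorObj ((Scheme.Modules.pullback q).obj N) (boxTensor p q E F) :=
  tensorMapIso (Iso.refl _) (pullbackTensorIso q hN hF) ≪≫
    (tensorAssoc _ _ _).symm ≪≫ tensorMapIso (tensorComm _ _) (Iso.refl _) ≪≫ tensorAssoc _ _ _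

/-- Unfolding of `boxTensorTwistIso`. [cite: StacksProject, Tag 01CA] -/
theorem boxTensorTwistIso_hom (p : Z ⟶ X) (q : Z ⟶ Y) (E : X.Modules) {N F : Y.Modules} (hN : IsFiniteLocallyFree N)
    (hF : IsFiniteLocallyFree F) :
    (boxTensorTwistIso p q E hN hF).hom =
      tensorMap (𝟙 _) (pullbackTensorHom q N F) ≫ (tensorAssoc _ _ _).inv ≫ tensorMap (tensorComm _ _).hom (𝟙 _) ≫
        (tensorAssoc _ _ _).hom := rfl

/-- **Naturality of `boxTensorTwistIso`** in `φ : E → E'` and maps of vector bundles `ψ : F → F'`: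
`(φ ⊠ (N ⊗ ψ)) ≫ iso = iso ≫ (q^*N ⊗ (φ ⊠ ψ))`. [cite: StacksProject, Tag 01CA (Lemma 17.16.1)] -/
theorem boxTensorTwistIso_hom_naturality (p : Z ⟶ X) (q : Z ⟶ Y) {E E' : X.Modules} {N F F' : Y.Modules}
    (hN : IsFiniteLocallyFree N) (hF : IsFiniteLocallyFree F) (hF' : IsFiniteLocallyFree F') (φ : E ⟶ E') (ψ : F ⟶ F') :
    boxTensorMap p q φ (tensorMap (𝟙 N) ψ) ≫ (boxTensorTwistIso p q E' hN hF').hom =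
      (boxTensorTwistIso p q E hN hF).hom ≫ tensorMap (𝟙 _) (boxTensorMap p q φ ψ) := by
  have h1 : tensorMap ((Scheme.Modules.pullback p).map φ) ((Scheme.Modules.pullback q).map (tensorMap (𝟙 N) ψ)) ≫
      tensorMap (𝟙 _) (pullbackTensorHom q N F') =
        tensorMap (𝟙 _) (pullbackTensorHom q N F) ≫
          tensorMap ((Scheme.Modules.pullback p).map φ) (tensorMap (𝟙 _) ((Scheme.Modules.pullback q).map ψ)) := by
    rw [← tensorMap_comp, ← tensorMap_comp, Category.comp_id, Category.id_comp, pullbackTensorHom_naturality,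
      CategoryTheory.Functor.map_id]
  have h3 : tensorMap (tensorMap ((Scheme.Modules.pullback p).map φ) (𝟙 ((Scheme.Modules.pullback q).obj N)))
      ((Scheme.Modules.pullback q).map ψ) ≫ tensorMap (tensorComm _ _).hom (𝟙 _) =
        tensorMap (tensorComm _ _).hom (𝟙 _) ≫
          tensorMap (tensorMap (𝟙 ((Scheme.Modules.pullback q).obj N)) ((Scheme.Modules.pullback p).map φ))
            ((Scheme.Modules.pullback q).map ψ) := by
    rw [← tensorMap_comp, ← tensorMap_comp, Category.comp_id, Category.id_comp, tensorMap_tensorComm_hom]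
  rw [boxTensorTwistIso_hom, boxTensorTwistIso_hom, boxTensorMap, boxTensorMap]
  simp only [Category.assoc]
  rw [reassoc_of% h1, tensorAssoc_inv_naturality_assoc, reassoc_of% h3, tensorAssoc_naturality]

/-- `pullbackBoxTensorIso'` against the first differential (the form `mapBifunctorIsoOfComponents` consumes: `φ ⊠ 𝟙` on inverses).
[cite: StacksProject, Tag 01CA (Lemma 17.16.4)] -/
theorem pullbackBoxTensorIso'_inv_naturality_left (hp : g ≫ p = p' ≫ u) (hq : g ≫ q = q') {E E' : X.Modules} {F : Y.Modules}
    (hE : IsFiniteLocallyFree E) (hE' : IsFiniteLocallyFree E') (hF : IsFiniteLocallyFree F) (φ : E ⟶ E') :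
    tensorMap ((Scheme.Modules.pullback p').map ((Scheme.Modules.pullback u).map φ)) (𝟙 ((Scheme.Modules.pullback q').obj F)) ≫
        (pullbackBoxTensorIso' hp hq hE' hF).inv =
      (pullbackBoxTensorIso' hp hq hE hF).inv ≫
        (Scheme.Modules.pullback g).map
          (tensorMap ((Scheme.Modules.pullback p).map φ) (𝟙 ((Scheme.Modules.pullback q).obj F))) := by
  have h := pullbackBoxTensorIso'_hom_naturality hp hq hE hE' hF hF φ (𝟙 F)
  rw [boxTensorMap, boxTensorMap, CategoryTheory.Functor.map_id, CategoryTheory.Functor.map_id] at h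
  rw [Iso.comp_inv_eq, Category.assoc, Iso.eq_inv_comp]
  exact h.symm

/-- `pullbackBoxTensorIso'` against the second differential (`𝟙 ⊠ ψ` on inverses). [cite: StacksProject, Tag 01CA (Lemma 17.16.4)] -/
theorem pullbackBoxTensorIso'_inv_naturality_right (hp : g ≫ p = p' ≫ u) (hq : g ≫ q = q') {E : X.Modules} {F F' : Y.Modules}
    (hE : IsFiniteLocallyFree E) (hF : IsFiniteLocallyFree F) (hF' : IsFiniteLocallyFree F') (ψ : F ⟶ F') :
    tensorMap (𝟙 ((Scheme.Modules.pullback p').obj ((Scheme.Modules.pullback u).obj E))) ((Scheme.Modules.pullback q').map ψ) ≫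
        (pullbackBoxTensorIso' hp hq hE hF').inv =
      (pullbackBoxTensorIso' hp hq hE hF).inv ≫
        (Scheme.Modules.pullback g).map
          (tensorMap (𝟙 ((Scheme.Modules.pullback p).obj E)) ((Scheme.Modules.pullback q).map ψ)) := by
  have h := pullbackBoxTensorIso'_hom_naturality hp hq hE hE hF hF' (𝟙 E) ψ
  rw [boxTensorMap, boxTensorMap, CategoryTheory.Functor.map_id, CategoryTheory.Functor.map_id,
    CategoryTheory.Functor.map_id] at h
  rw [Iso.comp_inv_eq, Category.assoc, Iso.eq_inv_comp]
  exact h.symm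

/-- `boxTensorTwistIso` against the first differential (`φ ⊠ 𝟙`). [cite: StacksProject, Tag 01CA (Lemma 17.16.1)] -/
theorem boxTensorTwistIso_hom_naturality_left (p : Z ⟶ X) (q : Z ⟶ Y) {E E' : X.Modules} {N F : Y.Modules}
    (hN : IsFiniteLocallyFree N) (hF : IsFiniteLocallyFree F) (φ : E ⟶ E') :
    tensorMap ((Scheme.Modules.pullback p).map φ) (𝟙 ((Scheme.Modules.pullback q).obj (tensorObj N F))) ≫
        (boxTensorTwistIso p q E' hN hF).hom =
      (boxTensorTwistIso p q E hN hF).hom ≫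
        tensorMap (𝟙 ((Scheme.Modules.pullback q).obj N))
          (tensorMap ((Scheme.Modules.pullback p).map φ) (𝟙 ((Scheme.Modules.pullback q).obj F))) := by
  have h := boxTensorTwistIso_hom_naturality p q hN hF hF φ (𝟙 F)
  rw [boxTensorMap, boxTensorMap, tensorMap_id, CategoryTheory.Functor.map_id, CategoryTheory.Functor.map_id] at h
  exact h

/-- `boxTensorTwistIso` against the second differential (`𝟙 ⊠ (N ⊗ ψ)`). [cite: StacksProject, Tag 01CA (Lemma 17.16.1)] -/
theorem boxTensorTwistIso_hom_naturality_right (p : Z ⟶ X) (q : Z ⟶ Y) (E : X.Modules) {N F F' : Y.Modules}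
    (hN : IsFiniteLocallyFree N) (hF : IsFiniteLocallyFree F) (hF' : IsFiniteLocallyFree F') (ψ : F ⟶ F') :
    tensorMap (𝟙 ((Scheme.Modules.pullback p).obj E)) ((Scheme.Modules.pullback q).map (tensorMap (𝟙 N) ψ)) ≫
        (boxTensorTwistIso p q E hN hF').hom =
      (boxTensorTwistIso p q E hN hF).hom ≫
        tensorMap (𝟙 ((Scheme.Modules.pullback q).obj N))
          (tensorMap (𝟙 ((Scheme.Modules.pullback p).obj E)) ((Scheme.Modules.pullback q).map ψ)) := by
  have h := boxTensorTwistIso_hom_naturality p q hN hF hF' (𝟙 E) ψ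
  rw [boxTensorMap, boxTensorMap, CategoryTheory.Functor.map_id] at h
  exact h

end Terms

/-! ### §2 The isomorphisms of cochain complexes -/

section Complexes

variable (R : CochainComplex X.Modules ℤ) (S : CochainComplex Y.Modules ℤ)
  (hR : ∀ i, IsFiniteLocallyFree (R.X i)) (hS : ∀ j, IsFiniteLocallyFree (S.X j))

/-- **Base change of `R ⊠ S` along a map of spans, as cochain complexes**: for `g ≫ p = p' ≫ u`, `g ≫ q = q'` and complexes `R`, `S`
of vector bundles, `(u^*•R) ⊠_{p',q'} S ≅ g^*•(R ⊠_{p,q} S)` (termwise `pullbackBoxTensorIso'`; `g^*` is a left adjoint, so it preserves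
the coproducts of the total complex). [cite: StacksProject, Tag 01CA (Lemma 17.16.4) and Tag 0FXX] [cite: Weibel1994, §1.2, 1.2.6] -/
def pullbackBoxTensorComplexIso (hp : g ≫ p = p' ≫ u) (hq : g ≫ q = q') :
    boxTensorComplex p' q' (((Scheme.Modules.pullback u).mapHomologicalComplex (ComplexShape.up ℤ)).obj R) S ≅
      ((Scheme.Modules.pullback g).mapHomologicalComplex (ComplexShape.up ℤ)).obj (boxTensorComplex p q R S) :=
  haveI := preservesZeroMorphisms_boxTensorFunctor p q
  haveI := preservesZeroMorphisms_boxTensorFunctor_obj p q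
  haveI := preservesZeroMorphisms_boxTensorFunctor p' q'
  haveI := preservesZeroMorphisms_boxTensorFunctor_obj p' q'
  mapBifunctorIsoOfComponents R S (((Scheme.Modules.pullback u).mapHomologicalComplex (ComplexShape.up ℤ)).obj R) S
    (boxTensorFunctor p q) (boxTensorFunctor p' q') (Scheme.Modules.pullback g)
    (fun i j => (pullbackBoxTensorIso' hp hq (hR i) (hS j)).symm)
    (fun i i' j => pullbackBoxTensorIso'_inv_naturality_left hp hq (hR i) (hR i') (hS j) (R.d i i'))
    (fun i j j' => pullbackBoxTensorIso'_inv_naturality_right hp hq (hR i) (hS j) (hS j') (S.d j j'))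
    (ComplexShape.up ℤ)

/-- **Twisting the second factor, as cochain complexes**: for complexes `R`, `S` with `S` of vector bundles and a finite locally free
`N` on `Y`, `R ⊠ (N ⊗ •S) ≅ (q^*N ⊗ –)•(R ⊠ S)` (termwise `boxTensorTwistIso`; `q^*N ⊗ –` is a left adjoint — the tree's
`tensorSheafHomAdj` — so it preserves the coproducts of the total complex). [cite: StacksProject, Tag 01CA and Tag 0FXX]
[cite: Weibel1994, §1.2, 1.2.6] -/
def boxTensorComplexTwistIso (p : Z ⟶ X) (q : Z ⟶ Y) {N : Y.Modules} (hN : IsFiniteLocallyFree N) :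
    haveI : ((tensorBifunctor Y).obj N).Additive := additive_tensorBifunctor_obj N
    haveI : ((tensorBifunctor Z).obj ((Scheme.Modules.pullback q).obj N)).Additive := additive_tensorBifunctor_obj _
    boxTensorComplex p q R ((((tensorBifunctor Y).obj N).mapHomologicalComplex (ComplexShape.up ℤ)).obj S) ≅
      ((((tensorBifunctor Z).obj ((Scheme.Modules.pullback q).obj N)).mapHomologicalComplex (ComplexShape.up ℤ)).obj
        (boxTensorComplex p q R S)) :=
  haveI : ((tensorBifunctor Y).obj N).Additive := additive_tensorBifunctor_obj N
  haveI : ((tensorBifunctor Z).obj ((Scheme.Modules.pullback q).obj N)).Additive := additive_tensorBifunctor_obj _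
  haveI := isLeftAdjoint_tensorBifunctor_obj (X := Z) ((Scheme.Modules.pullback q).obj N)
  haveI := preservesZeroMorphisms_boxTensorFunctor p q
  haveI := preservesZeroMorphisms_boxTensorFunctor_obj p q
  mapBifunctorIsoOfComponents R S R ((((tensorBifunctor Y).obj N).mapHomologicalComplex (ComplexShape.up ℤ)).obj S)
    (boxTensorFunctor p q) (boxTensorFunctor p q) ((tensorBifunctor Z).obj ((Scheme.Modules.pullback q).obj N))
    (fun i j => boxTensorTwistIso p q (R.X i) hN (hS j))
    (fun i i' j => boxTensorTwistIso_hom_naturality_left p q hN (hS j) (R.d i i'))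
    (fun i j j' => boxTensorTwistIso_hom_naturality_right p q (R.X i) hN (hS j) (hS j') (S.d j j'))
    (ComplexShape.up ℤ)

/-- **Both at once** (the form consumed at a point `(a, α)` of `A × Â`): `(u^*•R) ⊠_{p',q'} (N ⊗ •S) ≅ g^*•((q^*N ⊗ –)•(R ⊠_{p,q} S))`.
[cite: StacksProject, Tag 01CA and Tag 0FXX] [cite: Weibel1994, §1.2, 1.2.6] -/
def boxTensorComplexTwistPullbackIso (hp : g ≫ p = p' ≫ u) (hq : g ≫ q = q') {N : Y.Modules} (hN : IsFiniteLocallyFree N) :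
    haveI : ((tensorBifunctor Y).obj N).Additive := additive_tensorBifunctor_obj N
    haveI : ((tensorBifunctor Z).obj ((Scheme.Modules.pullback q).obj N)).Additive := additive_tensorBifunctor_obj _
    boxTensorComplex p' q' (((Scheme.Modules.pullback u).mapHomologicalComplex (ComplexShape.up ℤ)).obj R)
        ((((tensorBifunctor Y).obj N).mapHomologicalComplex (ComplexShape.up ℤ)).obj S) ≅
      ((Scheme.Modules.pullback g).mapHomologicalComplex (ComplexShape.up ℤ)).obj
        (((((tensorBifunctor Z).obj ((Scheme.Modules.pullback q).obj N)).mapHomologicalComplex (ComplexShape.up ℤ)).obj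
          (boxTensorComplex p q R S))) :=
  haveI : ((tensorBifunctor Y).obj N).Additive := additive_tensorBifunctor_obj N
  haveI : ((tensorBifunctor Z).obj ((Scheme.Modules.pullback q).obj N)).Additive := additive_tensorBifunctor_obj _
  pullbackBoxTensorComplexIso R ((((tensorBifunctor Y).obj N).mapHomologicalComplex (ComplexShape.up ℤ)).obj S) hR
      (fun j => isFiniteLocallyFree_tensorObj _ _ hN (hS j)) hp hq ≪≫
    ((Scheme.Modules.pullback g).mapHomologicalComplex (ComplexShape.up ℤ)).mapIso (boxTensorComplexTwistIso R S hS p q hN)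

end Complexes

end Literature.AlgebraicGeometry.Modules

end
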